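import Summits.AtomisticToContinuum.HydrodynamicLimit.Theorems.InfluenceLocality.Negative.KillCriterion

/-!
# `InfluenceLocality` (stmt-AtomisticToContinuum-13916) — ignition templates (objects)

The constructible hypothesis `IgnitionTemplates` of the refutation of the crux `InfluenceLocality`
(line `ignition-cascade-refutation`, lead c1, 2026-08-16), its tolerance boxes, and the auxiliary
objects of the Gibbs-cost bookkeeping (`boxWeight`, `costKappa`, `symBox`).

An **ignition template** for `N + 1` spheres of diameter `ε_N = σ ℓ_N` on `𝕋³` (`ℓ_N = (N+1)^{-1/3}`)
is a designed initial datum — nominal positions `p`, nominal velocities `w`, per-particle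
tolerances `rx, rv`, one distinguished fast particle `src` (the intruder; every other particle is
COLD, speed `≤ vc`), and a set `K` of at least `3/4` of the particles — such that

* (statics) the tolerance boxes are `ε_N + 2·vc·Tℓ_N`-separated, the Gibbs cost functional
  `∑ (‖w‖² − log((N+1)·rx³) − log rv³)` is `≤ C (N+1)` (O(1) nats per particle), and the template is
  not denser than `c₀ (D+1)³` particles in a ball of radius `D ℓ_N` about the intruder;
* (IGNITION) from every initial datum in the tolerance box, EVERY hard-sphere trajectory changes
  the velocity of every particle of `K` before the macroscopic time `T ℓ_N`.

`IgnitionTemplates` asks for such templates at arbitrarily small reduced density `σ`, some horizon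
`T`, constants uniform in `N`, and infinitely many `N`. It is a purely kinematic statement about
finitely many hard spheres (no Gibbs measure, no forecast, no exponential moment); the intended
construction is a designed branching ("express octree") collision cascade ignited by one
Maxwellian intruder of kinetic energy `O(N)` in a cold lattice gas. The companion files
`Negative/IgnitionStatics.lean` (Gibbs mass of the symmetrised box `≥ e^{-(C+κ)(N+1)}`) and
`Negative/InfluenceLocalityFalseOfIgnitionTemplates.lean` (`IgnitionTemplates → ¬ InfluenceLocality`)
consume these objects. Nothing here asserts a Theses decl positively.
-/

namespace Summit.AtomisticToContinuum.HydrodynamicLimit.Theorems.InfluenceLocality.Negative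

open MeasureTheory Set
open scoped Classical ENNReal
open Literature.Analysis.FluidPDE Literature.MathematicalPhysics.KineticTheory
open Summit.AtomisticToContinuum.HydrodynamicLimit.Theses.AntiMazurCoboundaries (InfluenceLocality)

noncomputable section

/-- The **tolerance box** of a template `(p, w, rx, rv)`: configurations whose particle `i` sits
within minimal-image distance `rx i` of the nominal position `p i` with velocity within `rv i` of
the nominal velocity `w i`, for every `i`. -/
def templateBox {n : ℕ} (p : Fin n → T3) (w : Fin n → V3) (rx rv : Fin n → ℝ) :
    Set (Config n (Fin 3) T3) :=
  {z | ∀ i, Torus.euclidDist (z i).1 (p i) ≤ rx i ∧ ‖(z i).2 - w i‖ ≤ rv i}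

/-- **Ignition template** for `N + 1` spheres of reduced diameter `σ` on `𝕋³`, horizon `T`
(microscopic units), cold-speed bound `vc`, cost constant `C`, packing constant `c₀`: nominal data
`(p, w)`, tolerances `(rx, rv)`, intruder `src`, kicked set `K`. See the module docstring. -/
structure IsIgnitionTemplate (σ T vc C c₀ : ℝ) (N : ℕ) (p : Fin (N + 1) → T3)
    (w : Fin (N + 1) → V3) (rx rv : Fin (N + 1) → ℝ) (src : Fin (N + 1))
    (K : Finset (Fin (N + 1))) : Prop where
  /-- position tolerances are positive … -/
  rx_pos : ∀ i, 0 < rx i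
  /-- … and at most `ℓ/8` -/
  rx_le : ∀ i, rx i ≤ ell N / 8
  /-- velocity tolerances are positive … -/
  rv_pos : ∀ i, 0 < rv i
  /-- … and at most `1` -/
  rv_le : ∀ i, rv i ≤ 1
  /-- the cold-speed bound is nonnegative -/
  vc_nonneg : 0 ≤ vc
  /-- every particle but the intruder is cold: its speeds in the box are `≤ vc` -/
  cold : ∀ i, i ≠ src → ‖w i‖ + rv i ≤ vc
  /-- the boxes are separated by more than a diameter plus the cold drift over `[0, Tℓ]` -/
  sep : ∀ i j, i ≠ j →
    hsDiameter σ N + 2 * vc * (T * ell N) < Torus.euclidDist (p i) (p j) - rx i - rx j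
  /-- Gibbs cost: `O(1)` nats per particle -/
  cost : ∑ i, (‖w i‖ ^ 2 - Real.log (((N + 1 : ℕ) : ℝ) * rx i ^ 3) - Real.log (rv i ^ 3)) ≤
    C * (N + 1)
  /-- packing about the intruder: at most `c₀ (D+1)³` nominal positions within `D ℓ` of `p src` -/
  packing : ∀ D : ℝ, 0 ≤ D →
    ((Finset.univ.filter fun i => Torus.euclidDist (p i) (p src) ≤ D * ell N).card : ℝ) ≤
      c₀ * (D + 1) ^ 3
  /-- the intruder is not claimed to be kicked -/
  src_notMem : src ∉ K
  /-- at least three quarters of the particles are kicked -/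
  card_K : 3 * (N + 1) ≤ 4 * K.card
  /-- IGNITION: every hard-sphere trajectory issued from the box changes the velocity of every
  particle of `K` before time `Tℓ` -/
  ignition : ∀ z ∈ templateBox p w rx rv, ∀ γ : ℝ → Config (N + 1) (Fin 3) T3,
    IsHardSphereTrajectory (Torus.geometry (Fin 3)) (hsDiameter σ N) (N + 1) γ → γ 0 = z →
    ∀ i ∈ K, ∃ t ∈ Set.Icc (0 : ℝ) (T * ell N), (γ t i).2 ≠ (z i).2

/-- Ignition templates at `(σ, T, vc, C, c₀)` exist for infinitely many particle numbers. -/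
def HasIgnitionTemplates (σ T vc C c₀ : ℝ) : Prop :=
  ∀ N₀ : ℕ, ∃ N : ℕ, N₀ ≤ N ∧ ∃ (p : Fin (N + 1) → T3) (w : Fin (N + 1) → V3)
    (rx rv : Fin (N + 1) → ℝ) (src : Fin (N + 1)) (K : Finset (Fin (N + 1))),
    IsIgnitionTemplate σ T vc C c₀ N p w rx rv src K

/-- **IGNITION TEMPLATES** (the constructible hypothesis of the refutation of `InfluenceLocality`):
at arbitrarily small reduced density `σ` there are a horizon `T > 0` and constants `vc, C, c₀` with
ignition templates for infinitely many `N`. -/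
def IgnitionTemplates : Prop :=
  ∀ σ₀ : ℝ, 0 < σ₀ → ∃ σ : ℝ, 0 < σ ∧ σ < σ₀ ∧
    ∃ T vc C c₀ : ℝ, 0 < T ∧ HasIgnitionTemplates σ T vc C c₀

/-- The one-particle Gibbs weight of a template slot: box volumes times the minimum of the unit
Maxwellian over the velocity ball. -/
def boxWeight (w : V3) (rx rv : ℝ) : ℝ :=
  (Real.pi * 4 / 3 * rx ^ 3) * (Real.pi * 4 / 3 * rv ^ 3) *
    ((2 * Real.pi) ^ (-(3 : ℝ) / 2) * Real.exp (-(‖w‖ + rv) ^ 2 / 2))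

/-- The universal additive constant of the cost bound. -/
def costKappa : ℝ := 3 / 2 * Real.log (2 * Real.pi) + 3

/-- The union over all relabellings of the tolerance boxes. -/
def symBox {n : ℕ} (p : Fin n → T3) (w : Fin n → V3) (rx rv : Fin n → ℝ) :
    Set (Config n (Fin 3) T3) :=
  ⋃ π : Equiv.Perm (Fin n), templateBox (p ∘ π.symm) (w ∘ π.symm) (rx ∘ π.symm) (rv ∘ π.symm)


end

end Summit.AtomisticToContinuum.HydrodynamicLimit.Theorems.InfluenceLocality.Negative
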